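import Mathlib
import Summits.Ventures.PercRepro2.ReimerUnion

/-!
# From the butterfly to the two-copy (uniform-measure) form: van den Berg–Jonasson's cells (PercRepro2, mine-1)

Pairs `(S, T)` of configurations on `U` are partitioned into cells indexed by the agreement set
`K = {i ∈ U : i ∈ S ↔ i ∈ T}` and the common trace `α = S ∩ K`; inside a cell `γ = S \ K` is free in
`𝒫(U \ K)` and `T = α ∪ ((U \ K) \ γ)`.  On each cell the butterfly inequality on the sub-cube `U \ K`
(here `reimer_union_decr`) bounds the number of pairs whose first coordinate is a disjoint occurrence by
the number of pairs `(S, T)` with `S` in the first event and `T` in the second.  Summing the cells: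

  `#{S : (E₁ □ F₁ ∨ E₂ □ F₂) ∧ D} · 2^|U| ≤ #{(S, T) : (E₁ S ∧ D S ∧ F₁ T) ∨ (E₂ S ∧ D S ∧ F₂ T)}`

(`bk_union_decr_uniform`): the uniform-measure form of `MINE-1.md` Corollary 16.8; with one pair and
`D = ⊤` it is the classical BK inequality for the uniform measure in counting form.
-/

namespace Summit.Ventures.PercRepro2

namespace ReimerCube

variable {E : Type*} [DecidableEq E]

open Classical in
/-- The cell decomposition of `𝒫(U) × 𝒫(U)`: the pairs satisfying `Q` are counted by the cells
`(K, α, γ)` with `α ⊆ K ⊆ U`, `γ ⊆ U \ K`, via `(S, T) = (α ∪ γ, α ∪ ((U \ K) \ γ))`. -/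
lemma card_pairs_eq_sum_cells (U : Finset E) (Q : Finset E → Finset E → Prop)
    [DecidablePred (fun p : Finset E × Finset E => Q p.1 p.2)]
    [∀ K α : Finset E, DecidablePred (fun γ => Q (α ∪ γ) (α ∪ ((U \ K) \ γ)))] :
    ((U.powerset ×ˢ U.powerset).filter (fun p => Q p.1 p.2)).card
      = ∑ K ∈ U.powerset, ∑ α ∈ K.powerset,
          ((U \ K).powerset.filter (fun γ => Q (α ∪ γ) (α ∪ ((U \ K) \ γ)))).card := by
  -- write the right side as the cardinality of a sigma finset
  have hsig : ∑ K ∈ U.powerset, ∑ α ∈ K.powerset,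
        ((U \ K).powerset.filter (fun γ => Q (α ∪ γ) (α ∪ ((U \ K) \ γ)))).card
      = (U.powerset.sigma (fun K => K.powerset.sigma
          (fun α => (U \ K).powerset.filter (fun γ => Q (α ∪ γ) (α ∪ ((U \ K) \ γ)))))).card := by
    rw [Finset.card_sigma]
    apply Finset.sum_congr rfl
    intro K _
    rw [Finset.card_sigma]
  rw [hsig]
  symm
  apply Finset.card_bij (fun x _ => (x.2.1 ∪ x.2.2, x.2.1 ∪ ((U \ x.1) \ x.2.2)))
  · -- maps into the filtered product
    rintro ⟨K, α, γ⟩ hx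
    simp only [Finset.mem_sigma, Finset.mem_powerset, Finset.mem_filter] at hx
    obtain ⟨hK, hα, hγ, hQ⟩ := hx
    simp only [Finset.mem_filter, Finset.mem_product, Finset.mem_powerset]
    refine ⟨⟨?_, ?_⟩, hQ⟩
    · exact Finset.union_subset (hα.trans hK) (hγ.trans Finset.sdiff_subset)
    · exact Finset.union_subset (hα.trans hK) (Finset.sdiff_subset.trans Finset.sdiff_subset)
  · -- injective
    rintro ⟨K, α, γ⟩ hx ⟨K', α', γ'⟩ hx' h
    simp only [Finset.mem_sigma, Finset.mem_powerset, Finset.mem_filter] at hx hx'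
    obtain ⟨hK, hα, hγ, -⟩ := hx
    obtain ⟨hK', hα', hγ', -⟩ := hx'
    simp only [Prod.mk.injEq] at h
    obtain ⟨h1, h2⟩ := h
    -- K is the agreement set of (S, T), α = S ∩ K, γ = S \ K
    have hKeq : K = K' := by
      ext i
      constructor
      · intro hi
        by_contra hi'
        have hiU : i ∈ U := hK hi
        have hiU' : i ∈ U \ K' := Finset.mem_sdiff.mpr ⟨hiU, hi'⟩
        -- i ∈ K: i ∈ S ↔ i ∈ T (both equal i ∈ α); i ∉ K': i ∈ S ↔ i ∉ T
        have hS : i ∈ α ∪ γ ↔ i ∈ α := by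
          constructor
          · intro h
            rcases Finset.mem_union.mp h with h | h
            · exact h
            · exact absurd (Finset.mem_sdiff.mp (hγ h)).2 (fun h' => h' hi)
          · intro h
            exact Finset.mem_union_left _ h
        have hT : i ∈ α ∪ ((U \ K) \ γ) ↔ i ∈ α := by
          constructor
          · intro h
            rcases Finset.mem_union.mp h with h | h
            · exact h
            · exact absurd (Finset.mem_sdiff.mp (Finset.mem_sdiff.mp h).1).2 (fun h' => h' hi)
          · intro h
            exact Finset.mem_union_left _ h
        have hS' : i ∈ α' ∪ γ' ↔ i ∈ γ' := by
          constructor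
          · intro h
            rcases Finset.mem_union.mp h with h | h
            · exact absurd (hα' h) hi'
            · exact h
          · intro h
            exact Finset.mem_union_right _ h
        have hT' : i ∈ α' ∪ ((U \ K') \ γ') ↔ i ∉ γ' := by
          constructor
          · intro h
            rcases Finset.mem_union.mp h with h | h
            · exact absurd (hα' h) hi'
            · exact (Finset.mem_sdiff.mp h).2
          · intro h
            exact Finset.mem_union_right _ (Finset.mem_sdiff.mpr ⟨hiU', h⟩)
        rw [h1] at hS
        rw [h2] at hT
        tauto
      · intro hi
        by_contra hi'
        have hiU : i ∈ U := hK' hi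
        have hiU' : i ∈ U \ K := Finset.mem_sdiff.mpr ⟨hiU, hi'⟩
        have hS : i ∈ α' ∪ γ' ↔ i ∈ α' := by
          constructor
          · intro h
            rcases Finset.mem_union.mp h with h | h
            · exact h
            · exact absurd (Finset.mem_sdiff.mp (hγ' h)).2 (fun h' => h' hi)
          · intro h
            exact Finset.mem_union_left _ h
        have hT : i ∈ α' ∪ ((U \ K') \ γ') ↔ i ∈ α' := by
          constructor
          · intro h
            rcases Finset.mem_union.mp h with h | h
            · exact h
            · exact absurd (Finset.mem_sdiff.mp (Finset.mem_sdiff.mp h).1).2 (fun h' => h' hi)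
          · intro h
            exact Finset.mem_union_left _ h
        have hS' : i ∈ α ∪ γ ↔ i ∈ γ := by
          constructor
          · intro h
            rcases Finset.mem_union.mp h with h | h
            · exact absurd (hα h) hi'
            · exact h
          · intro h
            exact Finset.mem_union_right _ h
        have hT' : i ∈ α ∪ ((U \ K) \ γ) ↔ i ∉ γ := by
          constructor
          · intro h
            rcases Finset.mem_union.mp h with h | h
            · exact absurd (hα h) hi'
            · exact (Finset.mem_sdiff.mp h).2
          · intro h
            exact Finset.mem_union_right _ (Finset.mem_sdiff.mpr ⟨hiU', h⟩)
        rw [← h1] at hS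
        rw [← h2] at hT
        tauto
    subst hKeq
    have hαeq : α = α' := by
      ext i
      constructor
      · intro hi
        have : i ∈ α' ∪ γ' := h1 ▸ Finset.mem_union_left _ hi
        rcases Finset.mem_union.mp this with h | h
        · exact h
        · exact absurd (hα hi) (Finset.mem_sdiff.mp (hγ' h)).2
      · intro hi
        have : i ∈ α ∪ γ := h1 ▸ Finset.mem_union_left _ hi
        rcases Finset.mem_union.mp this with h | h
        · exact h
        · exact absurd (hα' hi) (Finset.mem_sdiff.mp (hγ h)).2
    subst hαeq
    have hγeq : γ = γ' := by
      ext i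
      constructor
      · intro hi
        have : i ∈ α ∪ γ' := h1 ▸ Finset.mem_union_right _ hi
        rcases Finset.mem_union.mp this with h | h
        · exact absurd (hα h) (Finset.mem_sdiff.mp (hγ hi)).2
        · exact h
      · intro hi
        have : i ∈ α ∪ γ := h1 ▸ Finset.mem_union_right _ hi
        rcases Finset.mem_union.mp this with h | h
        · exact absurd (hα h) (Finset.mem_sdiff.mp (hγ' hi)).2
        · exact h
    subst hγeq
    rfl
  · -- surjective
    rintro ⟨S, T⟩ hp
    simp only [Finset.mem_filter, Finset.mem_product, Finset.mem_powerset] at hp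
    obtain ⟨⟨hS, hT⟩, hQ⟩ := hp
    refine ⟨⟨U.filter (fun i => i ∈ S ↔ i ∈ T), S ∩ U.filter (fun i => i ∈ S ↔ i ∈ T),
      S \ U.filter (fun i => i ∈ S ↔ i ∈ T)⟩, ?_, ?_⟩
    · simp only [Finset.mem_sigma, Finset.mem_powerset, Finset.mem_filter]
      refine ⟨Finset.filter_subset _ _, Finset.inter_subset_right, ?_, ?_⟩
      · intro i hi
        rw [Finset.mem_sdiff] at hi ⊢
        exact ⟨hS hi.1, hi.2⟩
      · have e1 : S ∩ U.filter (fun i => i ∈ S ↔ i ∈ T) ∪ S \ U.filter (fun i => i ∈ S ↔ i ∈ T) = S := by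
          ext i
          simp only [Finset.mem_union, Finset.mem_inter, Finset.mem_sdiff]
          tauto
        have e2 : S ∩ U.filter (fun i => i ∈ S ↔ i ∈ T)
            ∪ ((U \ U.filter (fun i => i ∈ S ↔ i ∈ T)) \ (S \ U.filter (fun i => i ∈ S ↔ i ∈ T))) = T := by
          ext i
          simp only [Finset.mem_union, Finset.mem_inter, Finset.mem_sdiff, Finset.mem_filter]
          have hSU : i ∈ S → i ∈ U := fun h => hS h
          have hTU : i ∈ T → i ∈ U := fun h => hT h
          tauto
        rw [e1, e2]
        exact hQ
    · simp only [Prod.mk.injEq]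
      constructor
      · ext i
        simp only [Finset.mem_union, Finset.mem_inter, Finset.mem_sdiff]
        tauto
      · ext i
        simp only [Finset.mem_union, Finset.mem_inter, Finset.mem_sdiff, Finset.mem_filter]
        have hSU : i ∈ S → i ∈ U := fun h => hS h
        have hTU : i ∈ T → i ∈ U := fun h => hT h
        tauto


/-! ## The two-copy (uniform-measure) inequality -/

/-- The shift of an event by a fixed red set `α`: `γ ↦ E (α ∪ γ)`. -/
def shift (α : Finset E) (A : Finset E → Prop) : Finset E → Prop := fun γ => A (α ∪ γ)

/-- The shift of an increasing event is increasing. -/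
lemma incr_shift {A : Finset E → Prop} (hA : Incr A) (α : Finset E) : Incr (shift α A) :=
  fun _ _ h hx => hA (Finset.union_subset_union (Finset.Subset.refl α) h) hx

/-- The shift of a decreasing event is decreasing. -/
lemma decr_shift {D : Finset E → Prop} (hD : Decr D) (α : Finset E) : Decr (shift α D) :=
  fun _ _ h hx => hD (Finset.union_subset_union (Finset.Subset.refl α) h) hx

/-- A disjoint occurrence at `α ∪ γ` yields a disjoint occurrence of the shifted events at `γ`
(van den Berg–Jonasson's `(A □ B)(α) ⊆ A(α) □ B(α)`). -/
lemma dOcc_shift {A B : Finset E → Prop} {α γ : Finset E} (h : DOcc A B (α ∪ γ)) :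
    DOcc (shift α A) (shift α B) γ := by
  obtain ⟨K, L, hK, hL, hKL, hAK, hBL⟩ := h
  refine ⟨K \ α, L \ α, ?_, ?_, ?_, ?_, ?_⟩
  · intro x hx
    have hx' := Finset.mem_sdiff.mp hx
    rcases Finset.mem_union.mp (hK hx'.1) with h | h
    · exact absurd h hx'.2
    · exact h
  · intro x hx
    have hx' := Finset.mem_sdiff.mp hx
    rcases Finset.mem_union.mp (hL hx'.1) with h | h
    · exact absurd h hx'.2
    · exact h
  · exact Finset.disjoint_of_subset_left Finset.sdiff_subset
      (Finset.disjoint_of_subset_right Finset.sdiff_subset hKL)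
  · intro T hT
    apply hAK
    intro x hx
    by_cases hxa : x ∈ α
    · exact Finset.mem_union_left _ hxa
    · exact Finset.mem_union_right _ (hT (Finset.mem_sdiff.mpr ⟨hx, hxa⟩))
  · intro T hT
    apply hBL
    intro x hx
    by_cases hxa : x ∈ α
    · exact Finset.mem_union_left _ hxa
    · exact Finset.mem_union_right _ (hT (Finset.mem_sdiff.mpr ⟨hx, hxa⟩))

open Classical in
/-- **Two-copy form of the union Reimer inequality (uniform measure; MINE-1 Cor. 16.8, counting form).**
For increasing `E₁ ⊆ E₂`, `F₂ ⊆ F₁` and decreasing `D`: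
`#{S : (E₁ □ F₁ ∨ E₂ □ F₂) ∧ D} · 2^|U| ≤ #{(S, T) : ((E₁ S ∧ F₁ T) ∨ (E₂ S ∧ F₂ T)) ∧ D S}`.
With one pair and `D = ⊤` this is the BK inequality for the uniform measure. -/
theorem bk_union_decr_uniform (U : Finset E) (E₁ E₂ F₁ F₂ D : Finset E → Prop)
    (hE₁ : Incr E₁) (hE₂ : Incr E₂) (hF₁ : Incr F₁) (hF₂ : Incr F₂) (hD : Decr D)
    (h12 : ∀ S, E₁ S → E₂ S) (h21 : ∀ S, F₂ S → F₁ S) :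
    (U.powerset.filter (fun S => (DOcc E₁ F₁ S ∨ DOcc E₂ F₂ S) ∧ D S)).card * 2 ^ U.card
      ≤ ((U.powerset ×ˢ U.powerset).filter
          (fun p => ((E₁ p.1 ∧ F₁ p.2) ∨ (E₂ p.1 ∧ F₂ p.2)) ∧ D p.1)).card := by
  -- the left side as a count of pairs
  have hL : (U.powerset.filter (fun S => (DOcc E₁ F₁ S ∨ DOcc E₂ F₂ S) ∧ D S)).card * 2 ^ U.card
      = ((U.powerset ×ˢ U.powerset).filter
          (fun p => (DOcc E₁ F₁ p.1 ∨ DOcc E₂ F₂ p.1) ∧ D p.1)).card := by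
    have e : (U.powerset ×ˢ U.powerset).filter
          (fun p => (DOcc E₁ F₁ p.1 ∨ DOcc E₂ F₂ p.1) ∧ D p.1)
        = (U.powerset.filter (fun S => (DOcc E₁ F₁ S ∨ DOcc E₂ F₂ S) ∧ D S)) ×ˢ U.powerset := by
      ext p
      simp only [Finset.mem_filter, Finset.mem_product]
      tauto
    rw [e, Finset.card_product, Finset.card_powerset]
  rw [hL]
  have h1 := card_pairs_eq_sum_cells U (fun S _ => (DOcc E₁ F₁ S ∨ DOcc E₂ F₂ S) ∧ D S)
  have h2 := card_pairs_eq_sum_cells U (fun S T => ((E₁ S ∧ F₁ T) ∨ (E₂ S ∧ F₂ T)) ∧ D S)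
  beta_reduce at h1 h2
  refine le_trans (le_of_eq h1) (le_trans ?_ (le_of_eq h2.symm))
  apply Finset.sum_le_sum
  intro K _
  apply Finset.sum_le_sum
  intro α _
  -- the cell inequality: shift by α and apply the butterfly on U \ K
  calc ((U \ K).powerset.filter
          (fun γ => (DOcc E₁ F₁ (α ∪ γ) ∨ DOcc E₂ F₂ (α ∪ γ)) ∧ D (α ∪ γ))).card
      ≤ ((U \ K).powerset.filter (fun γ =>
          (DOcc (shift α E₁) (shift α F₁) γ ∨ DOcc (shift α E₂) (shift α F₂) γ)
            ∧ shift α D γ)).card := by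
        apply Finset.card_le_card
        intro γ hγ
        rw [Finset.mem_filter] at hγ ⊢
        refine ⟨hγ.1, ?_, hγ.2.2⟩
        rcases hγ.2.1 with h | h
        · exact Or.inl (dOcc_shift h)
        · exact Or.inr (dOcc_shift h)
    _ ≤ ((U \ K).powerset.filter (fun γ =>
          ((shift α E₁ γ ∧ shift α F₁ ((U \ K) \ γ)) ∨ (shift α E₂ γ ∧ shift α F₂ ((U \ K) \ γ)))
            ∧ shift α D γ)).card :=
        reimer_union_decr (U \ K) (shift α E₁) (shift α E₂) (shift α F₁) (shift α F₂) (shift α D)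
          (incr_shift hE₁ α) (incr_shift hE₂ α) (incr_shift hF₁ α) (incr_shift hF₂ α)
          (decr_shift hD α) (fun S h => h12 _ h) (fun S h => h21 _ h)
    _ = ((U \ K).powerset.filter (fun γ =>
          ((E₁ (α ∪ γ) ∧ F₁ (α ∪ ((U \ K) \ γ))) ∨ (E₂ (α ∪ γ) ∧ F₂ (α ∪ ((U \ K) \ γ))))
            ∧ D (α ∪ γ))).card := rfl


open Classical in
/-- **The BK inequality for the uniform measure (counting form).**  For increasing `A`, `B`:
`#{S ⊆ U : A □ B at S} · 2^|U| ≤ #{S ⊆ U : A S} · #{T ⊆ U : B T}`. -/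
theorem bk_uniform (U : Finset E) (A B : Finset E → Prop) (hA : Incr A) (hB : Incr B) :
    (U.powerset.filter (fun S => DOcc A B S)).card * 2 ^ U.card
      ≤ (U.powerset.filter A).card * (U.powerset.filter B).card := by
  have h := bk_union_decr_uniform U A A B B (fun _ => True) hA hA hB hB
    (fun _ _ _ h => h) (fun _ h => h) (fun _ h => h)
  rw [← Finset.card_product]
  refine le_trans (Nat.mul_le_mul_right _ ?_) (le_trans h ?_)
  · apply Finset.card_le_card
    intro S hS
    simp only [Finset.mem_filter] at hS ⊢
    exact ⟨hS.1, Or.inl hS.2, trivial⟩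
  · apply Finset.card_le_card
    intro p hp
    simp only [Finset.mem_filter, Finset.mem_product] at hp ⊢
    tauto

open Classical in
/-- **Three-point inequality for a root (MINE-1 Cor. 16.8, uniform measure, counting form).**  For
increasing `A`, `B`, `C` (think `A = {s ↔ a}`, `B = {s ↔ b}`, `C = {s ↔ t}`):
`#{S : (A ∩ C) □ B ∨ A □ (B ∩ C)} · 2^|U| ≤ #{(S, T) : (A S ∧ C S ∧ B T) ∨ (A S ∧ B T ∧ C T)}`
— the right side is `|A ∩ C|·|B| + |A|·|B ∩ C| − |A ∩ C|·|B ∩ C|`. -/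
theorem three_point_uniform (U : Finset E) (A B C : Finset E → Prop)
    (hA : Incr A) (hB : Incr B) (hC : Incr C) :
    (U.powerset.filter (fun S => DOcc (fun T => A T ∧ C T) B S ∨ DOcc A (fun T => B T ∧ C T) S)).card
        * 2 ^ U.card
      ≤ ((U.powerset ×ˢ U.powerset).filter
          (fun p => (A p.1 ∧ C p.1 ∧ B p.2) ∨ (A p.1 ∧ B p.2 ∧ C p.2))).card := by
  have hAC : Incr (fun T => A T ∧ C T) := fun _ _ h hx => ⟨hA h hx.1, hC h hx.2⟩
  have hBC : Incr (fun T => B T ∧ C T) := fun _ _ h hx => ⟨hB h hx.1, hC h hx.2⟩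
  have h := bk_union_decr_uniform U (fun T => A T ∧ C T) A B (fun T => B T ∧ C T) (fun _ => True)
    hAC hA hB hBC (fun _ _ _ h => h) (fun _ h => h.1) (fun _ h => h.1)
  refine le_trans (Nat.mul_le_mul_right _ ?_) (le_trans h ?_)
  · apply Finset.card_le_card
    intro S hS
    simp only [Finset.mem_filter] at hS ⊢
    exact ⟨hS.1, hS.2, trivial⟩
  · apply Finset.card_le_card
    intro p hp
    simp only [Finset.mem_filter, Finset.mem_product] at hp ⊢
    tauto


open Classical in
/-- **Three-point inequality, explicit form (MINE-1 Cor. 16.8 at `p = 1/2`).**  For increasing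
`A`, `B`, `C` on `𝒫(U)`:
`#{(A∩C) □ B ∨ A □ (B∩C)} · 2^|U| + |A∩C|·|B∩C| ≤ |A∩C|·|B| + |A|·|B∩C|`. -/
theorem three_point_uniform' (U : Finset E) (A B C : Finset E → Prop)
    (hA : Incr A) (hB : Incr B) (hC : Incr C) :
    (U.powerset.filter (fun S => DOcc (fun T => A T ∧ C T) B S ∨ DOcc A (fun T => B T ∧ C T) S)).card
        * 2 ^ U.card
      + (U.powerset.filter (fun S => A S ∧ C S)).card * (U.powerset.filter (fun S => B S ∧ C S)).card
      ≤ (U.powerset.filter (fun S => A S ∧ C S)).card * (U.powerset.filter B).card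
        + (U.powerset.filter A).card * (U.powerset.filter (fun S => B S ∧ C S)).card := by
  have h := three_point_uniform U A B C hA hB hC
  -- the pair set is the union of two product sets whose intersection is the product of the intersections
  set P₁ := U.powerset.filter (fun S => A S ∧ C S) ×ˢ U.powerset.filter B with hP₁
  set P₂ := U.powerset.filter A ×ˢ U.powerset.filter (fun S => B S ∧ C S) with hP₂
  have hU : (U.powerset ×ˢ U.powerset).filter
        (fun p => (A p.1 ∧ C p.1 ∧ B p.2) ∨ (A p.1 ∧ B p.2 ∧ C p.2)) = P₁ ∪ P₂ := by
    ext p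
    simp only [hP₁, hP₂, Finset.mem_filter, Finset.mem_product, Finset.mem_union]
    tauto
  have hI : P₁ ∩ P₂ = U.powerset.filter (fun S => A S ∧ C S) ×ˢ U.powerset.filter (fun S => B S ∧ C S) := by
    ext p
    simp only [hP₁, hP₂, Finset.mem_filter, Finset.mem_product, Finset.mem_inter]
    tauto
  have hie := Finset.card_union_add_card_inter P₁ P₂
  rw [hI, Finset.card_product] at hie
  rw [hU] at h
  have h1 : P₁.card = (U.powerset.filter (fun S => A S ∧ C S)).card * (U.powerset.filter B).card :=
    Finset.card_product _ _
  have h2 : P₂.card = (U.powerset.filter A).card * (U.powerset.filter (fun S => B S ∧ C S)).card :=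
    Finset.card_product _ _
  omega

end ReimerCube

end Summit.Ventures.PercRepro2
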